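import Mathlib
import Literature.NumberTheory.LFunctions.Zhang2022.Section7dStatements
import HarnessLib

/-!
# Zhang (2022) §7, proof of Proposition 7.1 (c): the reindexing `S*ⱼ(𝐚₁,𝐚₂) ↦ S_j(𝐚₁,𝐚₂)` —
# nodes `Z22:§7.u055` and `Z22:(7.21)`, kernel-checked finite combinatorics

Topic `Literature/NumberTheory/LFunctions/Zhang2022` (Landau–Siegel audit tree; verdict-neutral).
D-0069 campaign, cell `siegel-zhang`, DISCHARGE lane (seat `sz-d25`). Y. Zhang, *Discrete mean
estimates and the Landau–Siegel zero*, arXiv:2211.02515v1 (2022) [Zhang2022LandauSiegel] — **an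
unrefereed manuscript under adjudication**; this file PROVES two of its typed proof steps
(`Section7dStatements`, slice L2-t5) and asserts nothing else — in particular nothing about its
Theorems 1–2 or about Landau–Siegel zeros. The passage is §7 p. 41, tex L2143–L2166, inside
"*Proof of Proposition 7.1: the main term*", between (7.20) and (7.21):

> "By the Möbius inversion, [`Σ_{(l,k)=1}` ↦ `Σ_l Σ_{r∣(k,l)} μ(r)`]. This yields, by substituting
> `k = rk₁`, `l = rm`, `n = d₁k₁` and changing the order of summation, `S*ⱼ(𝐚₁,𝐚₂) = Σ_r Σ_d
> |μ(r)|/(drφ(r)) (Σ_m a₁(drm)/m^{1−β_j}) Σ_n a₂(drn)λ₀ⱼ(drn)/n Σ_{n=d₁k₁,(k₁,r)=1}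
> κ̃₀ⱼ(d₁;drk₁)μ(k₁)k₁^{1−β_j}/φ(k₁)` [`Z22:§7.u055` = `Step7u055`]. Since
> `λ₀ⱼ(drn) = λ₀ⱼ(dr)λ̃₀ⱼ(n,dr)`, it follows that `λ₀ⱼ(drn)Σ_{n=d₁k₁,(k₁,r)=1}… = λ₀ⱼ(dr)ξ₀ⱼ(n;d,r)`
> [`Z22:§7.u057` = `Step7u057`]. Hence `S*ⱼ(𝐚₁,𝐚₂) = S_j(𝐚₁,𝐚₂)`. (7.21) [`Eq721`]"

| decl | node | content |
|---|---|---|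
| `step7u055_holds` | `Z22:§7.u055` | `Step7u055 c′` HOLDS (all `D`, `j`, all `𝐚₁, 𝐚₂` with (7.2)): Möbius inversion `Σ_{r∣(l,k)} μ(r) = 𝟙[(l,k)=1]`, the bijections `k = rk₁`, `l = rm`, `n = k₁d₁` on `[1, ⌈PT⁻²⌉)`, and termwise `μ(rk₁) = μ(r)μ(k₁)`, `φ(rk₁) = φ(r)φ(k₁)`, `(rk₁)^β = r^βk₁^β`, `μ(r)² = |μ(r)|` on `(k₁,r) = 1`, `μ(rk₁) = 0` off it; the range mismatches (`rk₁ < PT⁻²` vs `d₁k₁ < PT⁻²`, …) are absorbed EXACTLY by `a₁(n) = a₂(n) = 0` for `n ≥ PT⁻²` ((7.2), `Skeleton.Adm72`) — no index slip in print |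
| `eq721_of_steps` | `Z22:(7.21)` | the printed inference `Step7u055 ∧ Step7u057 ⇒ Eq721`: pull `λ₀ⱼ(dr)` out of the `n`-sum, swap `Σ_r Σ_d`; the result is `Skeleton.Sj` verbatim |
| `eq721_of_step7u057` | `Z22:(7.21)` | hence `Step7u057 c′ → Eq721 c′` |

`Step7u057` (node `Z22:§7.u057`) is another seat's discharge; it enters BY NAME as a hypothesis and
is not restated. No named fact, no numerics, no analysis: finite rearrangement over
`Finset.Ico 1 (Skeleton.Nsupp D)` only.

## References

* Y. Zhang, arXiv:2211.02515v1 (2022), §7 p. 41, proof of Proposition 7.1 (c), displays between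
  (7.20) and (7.21). [cite: Zhang2022LandauSiegel, §7 p.41, tex L2143–L2166]
-/

noncomputable section

open Complex Real Finset
open scoped ArithmeticFunction.Moebius ArithmeticFunction.zeta

namespace Literature.NumberTheory.LFunctions.Zhang2022.Section7dStatements

/-! ## Generic finite-sum tools -/

/-- `Σ_{r ∣ n} μ(r) = 𝟙[n = 1]` in `ℂ`. [folklore] -/
private theorem sum_divisors_moebius_complex_eq (n : ℕ) :
    ∑ r ∈ n.divisors, (μ r : ℂ) = if n = 1 then 1 else 0 := by
  have h := congrArg (fun f : ArithmeticFunction ℂ => f n)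
    (ArithmeticFunction.coe_moebius_mul_coe_zeta : (μ * ζ : ArithmeticFunction ℂ) = 1)
  simp only [ArithmeticFunction.coe_mul_zeta_apply, ArithmeticFunction.intCoe_apply,
    ArithmeticFunction.one_apply] at h
  exact h

/-- "By the Möbius inversion": a sum over `l` coprime to `k` is the full sum weighted by
`Σ_{r ∣ (l,k)} μ(r)`. [folklore] -/
private theorem sum_filter_coprime_eq_sum_moebius (I : Finset ℕ) (k : ℕ) (A : ℕ → ℂ) :
    ∑ l ∈ I.filter (fun l => Nat.Coprime l k), A l =
      ∑ l ∈ I, ∑ r ∈ (Nat.gcd l k).divisors, (μ r : ℂ) * A l := by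
  rw [Finset.sum_filter]
  refine Finset.sum_congr rfl fun l _ => ?_
  rw [← Finset.sum_mul, sum_divisors_moebius_complex_eq]
  by_cases h : Nat.Coprime l k
  · rw [if_pos h, if_pos (Nat.Coprime.gcd_eq_one h), one_mul]
  · have h' : ¬ Nat.gcd l k = 1 := fun h1 => h (Nat.coprime_iff_gcd_eq_one.mpr h1)
    rw [if_neg h, if_neg h', zero_mul]

/-- The substitution `k = r·k₁` on `[1, N)` (`r ≥ 1`). [folklore] -/
private theorem sum_Ico_filter_dvd_eq (r N : ℕ) (hr : 0 < r) (f : ℕ → ℂ) :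
    ∑ k ∈ (Finset.Ico 1 N).filter (fun k => r ∣ k), f k =
      ∑ k₁ ∈ (Finset.Ico 1 N).filter (fun k₁ => r * k₁ < N), f (r * k₁) := by
  refine Finset.sum_nbij' (fun k => k / r) (fun k₁ => r * k₁) ?_ ?_ ?_ ?_ ?_
  · intro k hk
    simp only [Finset.mem_filter, Finset.mem_Ico] at hk ⊢
    obtain ⟨⟨hk1, hkN⟩, hrk⟩ := hk
    refine ⟨⟨Nat.div_pos (Nat.le_of_dvd (by omega) hrk) hr,
      lt_of_le_of_lt (Nat.div_le_self k r) hkN⟩, ?_⟩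
    rw [Nat.mul_div_cancel' hrk]
    exact hkN
  · intro k₁ hk₁
    simp only [Finset.mem_filter, Finset.mem_Ico] at hk₁ ⊢
    exact ⟨⟨Nat.one_le_iff_ne_zero.mpr (Nat.mul_ne_zero (by omega) (by omega)), hk₁.2⟩,
      Dvd.intro k₁ rfl⟩
  · intro k hk
    exact Nat.mul_div_cancel' (Finset.mem_filter.mp hk).2
  · intro k₁ _
    exact Nat.mul_div_cancel_left k₁ hr
  · intro k hk
    rw [Nat.mul_div_cancel' (Finset.mem_filter.mp hk).2]

/-- "Changing the order of summation" for the Möbius variable: for `k, l ∈ [1, N)` the divisors `r`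
of `(l, k)` are exactly the `r ∈ [1, N)` dividing both. [folklore] -/
private theorem sum_sum_sum_divisors_gcd_comm (N : ℕ) (F : ℕ → ℕ → ℕ → ℂ) :
    ∑ k ∈ Finset.Ico 1 N, ∑ l ∈ Finset.Ico 1 N, ∑ r ∈ (Nat.gcd l k).divisors, F k l r =
      ∑ r ∈ Finset.Ico 1 N, ∑ k ∈ (Finset.Ico 1 N).filter (fun k => r ∣ k),
        ∑ l ∈ (Finset.Ico 1 N).filter (fun l => r ∣ l), F k l r := by
  have step1 : ∀ k ∈ Finset.Ico 1 N,
      ∑ l ∈ Finset.Ico 1 N, ∑ r ∈ (Nat.gcd l k).divisors, F k l r =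
        ∑ r ∈ (Finset.Ico 1 N).filter (fun r => r ∣ k),
          ∑ l ∈ (Finset.Ico 1 N).filter (fun l => r ∣ l), F k l r := by
    intro k hk
    rw [Finset.mem_Ico] at hk
    refine Finset.sum_comm' fun l r => ?_
    simp only [Finset.mem_filter, Finset.mem_Ico, Nat.mem_divisors]
    constructor
    · rintro ⟨⟨hl1, hlN⟩, hrdvd, _⟩
      obtain ⟨hrl, hrk⟩ := Nat.dvd_gcd_iff.mp hrdvd
      exact ⟨⟨⟨hl1, hlN⟩, hrl⟩, ⟨Nat.pos_of_dvd_of_pos hrk (by omega),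
        lt_of_le_of_lt (Nat.le_of_dvd (by omega) hrk) hk.2⟩, hrk⟩
    · rintro ⟨⟨⟨hl1, hlN⟩, hrl⟩, -, hrk⟩
      exact ⟨⟨hl1, hlN⟩, Nat.dvd_gcd hrl hrk, (Nat.gcd_pos_of_pos_left k (by omega)).ne'⟩
  rw [Finset.sum_congr rfl step1]
  refine Finset.sum_comm' fun k r => ?_
  simp only [Finset.mem_filter]
  tauto

/-- "Changing the order of summation" for the divisor variable: `Σ_{n<N} Σ_{k₁∣n,(k₁,r)=1}` is
`Σ_{k₁<N,(k₁,r)=1} Σ_{n<N, k₁∣n}`. [folklore] -/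
private theorem sum_sum_divisors_filter_comm (N r : ℕ) (F : ℕ → ℕ → ℂ) :
    ∑ n ∈ Finset.Ico 1 N, ∑ k₁ ∈ n.divisors.filter (fun k₁ => Nat.Coprime k₁ r), F n k₁ =
      ∑ k₁ ∈ (Finset.Ico 1 N).filter (fun k₁ => Nat.Coprime k₁ r),
        ∑ n ∈ (Finset.Ico 1 N).filter (fun n => k₁ ∣ n), F n k₁ := by
  refine Finset.sum_comm' fun n k₁ => ?_
  simp only [Finset.mem_filter, Finset.mem_Ico, Nat.mem_divisors]
  constructor
  · rintro ⟨⟨hn1, hnN⟩, ⟨hdvd, _⟩, hcop⟩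
    exact ⟨⟨⟨hn1, hnN⟩, hdvd⟩, ⟨Nat.pos_of_dvd_of_pos hdvd (by omega),
      lt_of_le_of_lt (Nat.le_of_dvd (by omega) hdvd) hnN⟩, hcop⟩
  · rintro ⟨⟨⟨hn1, hnN⟩, hdvd⟩, -, hcop⟩
    exact ⟨⟨hn1, hnN⟩, ⟨hdvd, by omega⟩, hcop⟩

/-- Two nested filtered sums as a sum over the full box of a guarded summand. [folklore] -/
private theorem sum_filter_sum_filter_eq_ite (s t : Finset ℕ) (p : ℕ → Prop) (q : ℕ → ℕ → Prop)
    [DecidablePred p] [∀ a, DecidablePred (q a)] (f : ℕ → ℕ → ℂ) :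
    ∑ a ∈ s.filter p, ∑ b ∈ t.filter (q a), f a b =
      ∑ a ∈ s, ∑ b ∈ t, if p a ∧ q a b then f a b else 0 := by
  rw [Finset.sum_filter]
  refine Finset.sum_congr rfl fun a _ => ?_
  by_cases hp : p a
  · rw [if_pos hp, Finset.sum_filter]
    refine Finset.sum_congr rfl fun b _ => ?_
    by_cases hq : q a b
    · rw [if_pos hq, if_pos ⟨hp, hq⟩]
    · rw [if_neg hq, if_neg (fun h => hq h.2)]
  · rw [if_neg hp]
    exact (Finset.sum_eq_zero fun b _ => if_neg (fun h => hp h.1)).symm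

/-- Reordering a five-fold sum over a box: `(r, d, m, k₁, d₁) ↦ (d, d₁, r, k₁, m)`. [folklore] -/
private theorem sum5_reorder (I : Finset ℕ) (G : ℕ → ℕ → ℕ → ℕ → ℕ → ℂ) :
    ∑ r ∈ I, ∑ d ∈ I, ∑ m ∈ I, ∑ k₁ ∈ I, ∑ d₁ ∈ I, G r d m k₁ d₁ =
      ∑ d ∈ I, ∑ d₁ ∈ I, ∑ r ∈ I, ∑ k₁ ∈ I, ∑ m ∈ I, G r d m k₁ d₁ := by
  calc ∑ r ∈ I, ∑ d ∈ I, ∑ m ∈ I, ∑ k₁ ∈ I, ∑ d₁ ∈ I, G r d m k₁ d₁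
      = ∑ d ∈ I, ∑ r ∈ I, ∑ m ∈ I, ∑ k₁ ∈ I, ∑ d₁ ∈ I, G r d m k₁ d₁ := Finset.sum_comm
    _ = ∑ d ∈ I, ∑ r ∈ I, ∑ k₁ ∈ I, ∑ d₁ ∈ I, ∑ m ∈ I, G r d m k₁ d₁ := by
        refine Finset.sum_congr rfl fun d _ => Finset.sum_congr rfl fun r _ => ?_
        refine Eq.trans Finset.sum_comm (Finset.sum_congr rfl fun k₁ _ => ?_)
        exact Finset.sum_comm
    _ = ∑ d ∈ I, ∑ d₁ ∈ I, ∑ r ∈ I, ∑ k₁ ∈ I, ∑ m ∈ I, G r d m k₁ d₁ := by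
        refine Finset.sum_congr rfl fun d _ => ?_
        refine Eq.trans (Finset.sum_congr rfl fun r _ => Finset.sum_comm) ?_
        exact Finset.sum_comm

/-- `μ(r k₁) = 0` unless `(k₁, r) = 1`. [folklore] -/
private theorem moebius_mul_eq_zero_of_not_coprime {r k₁ : ℕ} (h : ¬ Nat.Coprime k₁ r) :
    μ (r * k₁) = 0 :=
  ArithmeticFunction.moebius_eq_zero_of_not_squarefree
    fun hsq => h (Nat.squarefree_mul_iff.mp hsq).1.symm

/-- The support clause of (7.2): `a(n) = 0` for `n ≥ ⌈PT⁻²⌉ = Skeleton.Nsupp D`.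
[cite: Zhang2022LandauSiegel, §7 (7.2) p.33] -/
theorem eq_zero_of_nsupp_le {D : ℕ} {B : ℝ} {a : ℕ → ℂ} (ha : Skeleton.Adm72 D B a) {n : ℕ}
    (hn : Skeleton.Nsupp D ≤ n) : a n = 0 :=
  ha.2 n ((Nat.le_ceil _).trans (by exact_mod_cast hn))

/-! ## `Z22:§7.u055` holds -/

/-- **`Z22:§7.u055` DISCHARGED.** The node `Step7u055 c′` of `Section7dStatements` — "This yields,
by substituting `k = rk₁`, `l = rm`, `n = d₁k₁` and changing the order of summation,
`S*ⱼ(𝐚₁,𝐚₂) = Σ_r Σ_d |μ(r)|/(drφ(r)) Σ_m a₁(drm)m^{−(1−β_j)} Σ_n a₂(drn)λ₀ⱼ(drn)n⁻¹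
Σ_{n=d₁k₁,(k₁,r)=1} κ̃₀ⱼ(d₁;drk₁)μ(k₁)k₁^{1−β_j}/φ(k₁)`" (§7 p. 41) — HOLDS for all `D`, `j` and all
`𝐚₁, 𝐚₂` satisfying (7.2): both sides are brought to a guarded sum over the box
`[1,⌈PT⁻²⌉)⁵` (Möbius insertion `sum_filter_coprime_eq_sum_moebius`; the bijections
`sum_Ico_filter_dvd_eq`; the reorderings `sum_sum_sum_divisors_gcd_comm`,
`sum_sum_divisors_filter_comm`, `sum5_reorder`) and compared termwise (`key`).
[cite: Zhang2022LandauSiegel, §7 p.41, tex L2152] -/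
theorem step7u055_holds (c' : ℝ) : Step7u055 c' := by
  intro D B j a₁ a₂ ha₁ ha₂
  set N := Skeleton.Nsupp D with hN
  set I := Finset.Ico 1 N with hI
  set β := Skeleton.betaJ c' D j with hβ
  -- the two five-variable summands: Möbius side at `k = r k₁`, `l = r m`; divisor side at `n = k₁ d₁`
  obtain ⟨TL, hTL⟩ : ∃ TL : ℕ → ℕ → ℕ → ℕ → ℕ → ℂ, TL = fun (d d₁ r k₁ m : ℕ) =>
      a₂ (d₁ * d * (r * k₁)) * Skeleton.kappaTildeZero c' D j d₁ (d * (r * k₁)) *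
            Skeleton.lamZero c' D j (d₁ * d * (r * k₁)) * (μ (r * k₁) : ℂ) /
          ((d₁ : ℂ) * d * (Nat.totient (r * k₁) : ℂ) * ((r * k₁ : ℕ) : ℂ) ^ β) *
        ((μ r : ℂ) * (a₁ (d * (r * m)) / ((r * m : ℕ) : ℂ) ^ (1 - β))) := ⟨_, rfl⟩
  obtain ⟨TR, hTR⟩ : ∃ TR : ℕ → ℕ → ℕ → ℕ → ℕ → ℂ, TR = fun (r d m k₁ d₁ : ℕ) =>
      ((μ r).natAbs : ℂ) / ((d : ℂ) * r * (Nat.totient r : ℂ)) * (a₁ (d * r * m) / (m : ℂ) ^ (1 - β)) *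
        (a₂ (d * r * (k₁ * d₁)) * Skeleton.lamZero c' D j (d * r * (k₁ * d₁)) / ((k₁ * d₁ : ℕ) : ℂ) *
          (Skeleton.kappaTildeZero c' D j ((k₁ * d₁) / k₁) (d * r * k₁) * (μ k₁ : ℂ) *
            (k₁ : ℂ) ^ (1 - β) / (Nat.totient k₁ : ℂ))) := ⟨_, rfl⟩
  -- termwise identity of the two guarded summands
  have key : ∀ d d₁ r k₁ m : ℕ, 1 ≤ d → 1 ≤ d₁ → 1 ≤ r → 1 ≤ k₁ → 1 ≤ m →
      (if r * k₁ < N ∧ r * m < N then TL d d₁ r k₁ m else 0) =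
        (if Nat.Coprime k₁ r ∧ k₁ * d₁ < N then TR r d m k₁ d₁ else 0) := by
    intro d d₁ r k₁ m hd hd₁ hr hk₁ hm
    have hpos : 0 < d * r * (k₁ * d₁) :=
      Nat.mul_pos (Nat.mul_pos (by omega) (by omega)) (Nat.mul_pos (by omega) (by omega))
    have e1 : d₁ * d * (r * k₁) = d * r * (k₁ * d₁) := by ring
    by_cases hcop : Nat.Coprime k₁ r
    · by_cases hL : r * k₁ < N ∧ r * m < N
      · by_cases hR : k₁ * d₁ < N
        · rw [if_pos hL, if_pos ⟨hcop, hR⟩, hTL, hTR]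
          simp only [e1, show d * (r * k₁) = d * r * k₁ by ring,
            show d * (r * m) = d * r * m by ring, Nat.mul_div_cancel_left d₁ (show 0 < k₁ by omega)]
          have hμ : (μ (r * k₁) : ℂ) = (μ r : ℂ) * (μ k₁ : ℂ) := by
            rw [ArithmeticFunction.isMultiplicative_moebius.map_mul_of_coprime hcop.symm]
            push_cast; ring
          have hφ : (Nat.totient (r * k₁) : ℂ) = (Nat.totient r : ℂ) * (Nat.totient k₁ : ℂ) := by
            rw [Nat.totient_mul hcop.symm]; push_cast; ring
          have hr0 : (r : ℂ) ≠ 0 := by exact_mod_cast (show r ≠ 0 by omega)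
          have hk0 : (k₁ : ℂ) ≠ 0 := by exact_mod_cast (show k₁ ≠ 0 by omega)
          have hm0 : (m : ℂ) ≠ 0 := by exact_mod_cast (show m ≠ 0 by omega)
          have hd0 : (d : ℂ) ≠ 0 := by exact_mod_cast (show d ≠ 0 by omega)
          have hd₁0 : (d₁ : ℂ) ≠ 0 := by exact_mod_cast (show d₁ ≠ 0 by omega)
          have hφr : (Nat.totient r : ℂ) ≠ 0 := by
            exact_mod_cast (Nat.totient_pos.mpr (by omega)).ne'
          have hφk : (Nat.totient k₁ : ℂ) ≠ 0 := by
            exact_mod_cast (Nat.totient_pos.mpr (by omega)).ne'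
          have hX : (r : ℂ) ^ β ≠ 0 := by rw [cpow_def_of_ne_zero hr0]; exact Complex.exp_ne_zero _
          have hY : (k₁ : ℂ) ^ β ≠ 0 := by rw [cpow_def_of_ne_zero hk0]; exact Complex.exp_ne_zero _
          have hZ : (m : ℂ) ^ (1 - β) ≠ 0 := by
            rw [cpow_def_of_ne_zero hm0]; exact Complex.exp_ne_zero _
          have hpow1 : ((r * k₁ : ℕ) : ℂ) ^ β = (r : ℂ) ^ β * (k₁ : ℂ) ^ β := by
            push_cast; exact Complex.natCast_mul_natCast_cpow r k₁ β
          have hpow2 : ((r * m : ℕ) : ℂ) ^ (1 - β) = (r : ℂ) ^ (1 - β) * (m : ℂ) ^ (1 - β) := by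
            push_cast; exact Complex.natCast_mul_natCast_cpow r m (1 - β)
          have hpow3 : (r : ℂ) ^ (1 - β) = (r : ℂ) / (r : ℂ) ^ β := by
            rw [Complex.cpow_sub _ _ hr0, Complex.cpow_one]
          have hpow4 : (k₁ : ℂ) ^ (1 - β) = (k₁ : ℂ) / (k₁ : ℂ) ^ β := by
            rw [Complex.cpow_sub _ _ hk0, Complex.cpow_one]
          have hμr : ((μ r).natAbs : ℂ) = (μ r : ℂ) * (μ r : ℂ) := by
            rcases ArithmeticFunction.moebius_eq_or r with h | h | h <;> simp [h]
          have hkd : ((k₁ * d₁ : ℕ) : ℂ) = (k₁ : ℂ) * (d₁ : ℂ) := by push_cast; ring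
          rw [hμ, hφ, hpow1, hpow2, hpow3, hpow4, hμr, hkd]
          field_simp
        · -- `k₁ d₁ ≥ PT⁻²`: then `a₂(d₁ d r k₁) = 0`
          rw [if_pos hL, if_neg (fun h => hR h.2), hTL]
          have hz : a₂ (d₁ * d * (r * k₁)) = 0 := by
            refine eq_zero_of_nsupp_le ha₂ (le_trans (by omega : N ≤ k₁ * d₁) ?_)
            rw [e1]; exact Nat.le_of_dvd hpos ⟨d * r, by ring⟩
          simp [hz]
      · by_cases hR : k₁ * d₁ < N
        · -- `r k₁ ≥ PT⁻²` or `r m ≥ PT⁻²`: then `a₂(d r k₁ d₁) = 0` or `a₁(d r m) = 0`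
          rw [if_neg hL, if_pos ⟨hcop, hR⟩, hTR]
          rcases not_and_or.mp hL with h1 | h1
          · have hz : a₂ (d * r * (k₁ * d₁)) = 0 := by
              refine eq_zero_of_nsupp_le ha₂ (le_trans (by omega : N ≤ r * k₁) ?_)
              exact Nat.le_of_dvd hpos ⟨d * d₁, by ring⟩
            simp [hz]
          · have hz : a₁ (d * r * m) = 0 := by
              refine eq_zero_of_nsupp_le ha₁ (le_trans (by omega : N ≤ r * m) ?_)
              exact Nat.le_of_dvd (Nat.mul_pos (Nat.mul_pos (by omega) (by omega)) (by omega))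
                ⟨d, by ring⟩
            simp [hz]
        · rw [if_neg hL, if_neg (fun h => hR h.2)]
    · -- `(k₁, r) ≠ 1`: then `μ(r k₁) = 0`
      rw [if_neg (show ¬ (Nat.Coprime k₁ r ∧ k₁ * d₁ < N) from fun h => hcop h.1)]
      split_ifs with hL
      · rw [hTL]
        simp [moebius_mul_eq_zero_of_not_coprime hcop]
      · rfl
  -- (L) the left side: Möbius insertion, `r` outermost, `k = r k₁`, `l = r m`, guards
  have hL1 : SjStar c' D j a₁ a₂ =
      ∑ d ∈ I, ∑ d₁ ∈ I, ∑ k ∈ I, ∑ l ∈ I, ∑ r ∈ (Nat.gcd l k).divisors,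
        a₂ (d₁ * d * k) * Skeleton.kappaTildeZero c' D j d₁ (d * k) *
              Skeleton.lamZero c' D j (d₁ * d * k) * (μ k : ℂ) /
            ((d₁ : ℂ) * d * (Nat.totient k : ℂ) * (k : ℂ) ^ β) *
          ((μ r : ℂ) * (a₁ (d * l) / (l : ℂ) ^ (1 - β))) := by
    rw [SjStar]
    refine Finset.sum_congr rfl fun d _ => Finset.sum_congr rfl fun d₁ _ =>
      Finset.sum_congr rfl fun k _ => ?_
    rw [sum_filter_coprime_eq_sum_moebius, Finset.mul_sum]
    refine Finset.sum_congr rfl fun l _ => ?_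
    rw [Finset.mul_sum]
  have hL2 : SjStar c' D j a₁ a₂ = ∑ d ∈ I, ∑ d₁ ∈ I, ∑ r ∈ I, ∑ k₁ ∈ I, ∑ m ∈ I,
      (if r * k₁ < N ∧ r * m < N then TL d d₁ r k₁ m else 0) := by
    rw [hL1]
    refine Finset.sum_congr rfl fun d _ => Finset.sum_congr rfl fun d₁ _ => ?_
    rw [hI, sum_sum_sum_divisors_gcd_comm]
    refine Finset.sum_congr rfl fun r hr => ?_
    have hr1 : 0 < r := (Finset.mem_Ico.mp hr).1
    rw [sum_Ico_filter_dvd_eq r N hr1, ← hI,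
      ← sum_filter_sum_filter_eq_ite I I (fun k₁ => r * k₁ < N) (fun _ m => r * m < N)]
    refine Finset.sum_congr rfl fun k₁ _ => ?_
    rw [hI, sum_Ico_filter_dvd_eq r N hr1]
    refine Finset.sum_congr rfl fun m _ => ?_
    simp only [hTL]
  -- (R) the right side: distribution, `k₁` before `n`, `n = k₁ d₁`, guards
  have hR : (∑ r ∈ I, ∑ d ∈ I,
        ((μ r).natAbs : ℂ) / ((d : ℂ) * r * (Nat.totient r : ℂ)) *
          (∑ m ∈ I, a₁ (d * r * m) / (m : ℂ) ^ (1 - β)) *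
            ∑ n ∈ I, a₂ (d * r * n) * Skeleton.lamZero c' D j (d * r * n) / (n : ℂ) *
              ∑ k₁ ∈ n.divisors.filter (fun k₁ => Nat.Coprime k₁ r),
                Skeleton.kappaTildeZero c' D j (n / k₁) (d * r * k₁) * (μ k₁ : ℂ) *
                  (k₁ : ℂ) ^ (1 - β) / (Nat.totient k₁ : ℂ)) =
      ∑ r ∈ I, ∑ d ∈ I, ∑ m ∈ I, ∑ k₁ ∈ I, ∑ d₁ ∈ I,
        (if Nat.Coprime k₁ r ∧ k₁ * d₁ < N then TR r d m k₁ d₁ else 0) := by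
    refine Finset.sum_congr rfl fun r _ => Finset.sum_congr rfl fun d _ => ?_
    -- distribute into a triple sum in the order `m, n, k₁`
    simp only [Finset.mul_sum, Finset.sum_mul]
    refine Eq.trans (Finset.sum_congr rfl fun n _ => Finset.sum_comm) ?_
    refine Eq.trans Finset.sum_comm (Finset.sum_congr rfl fun m _ => ?_)
    rw [hI, sum_sum_divisors_filter_comm, ← hI,
      ← sum_filter_sum_filter_eq_ite I I (fun k₁ => Nat.Coprime k₁ r) (fun k₁ d₁ => k₁ * d₁ < N)]
    refine Finset.sum_congr rfl fun k₁ hk₁ => ?_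
    rw [hI, sum_Ico_filter_dvd_eq k₁ N (Finset.mem_Ico.mp (Finset.mem_filter.mp hk₁).1).1]
    refine Finset.sum_congr rfl fun d₁ _ => ?_
    simp only [hTR]
  -- compare termwise after reordering the right side to `(d, d₁, r, k₁, m)`
  rw [hL2, hR]
  conv_rhs => rw [sum5_reorder I]
  refine Finset.sum_congr rfl fun d hd => Finset.sum_congr rfl fun d₁ hd₁ =>
    Finset.sum_congr rfl fun r hr => Finset.sum_congr rfl fun k₁ hk₁ =>
    Finset.sum_congr rfl fun m hm => ?_
  rw [hI, Finset.mem_Ico] at hd hd₁ hr hk₁ hm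
  exact key d d₁ r k₁ m hd.1 hd₁.1 hr.1 hk₁.1 hm.1

variable (c' : ℝ) in
/-- `Step7u055` — `_holds` alias of `step7u055_holds` above under the fact's exact name, stated under the
prover's own binders as section variables (appended 2026-08-28, D-0026 bookkeeping: the proof term is the
existing theorem of this file; no statement, definition or attribute is edited; no new named fact; the
ledger's debt table listed the fact unproved). [cite: Zhang2022LandauSiegel, §7 p.41, tex L2152] -/
theorem _root_.Literature.NumberTheory.LFunctions.Zhang2022.Section7dStatements.Step7u055_holds :
    _root_.Literature.NumberTheory.LFunctions.Zhang2022.Section7dStatements.Step7u055 c' :=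
  _root_.Literature.NumberTheory.LFunctions.Zhang2022.Section7dStatements.step7u055_holds (c' := c')

/-! ## (7.21) from `Z22:§7.u055` and `Z22:§7.u057` -/

/-- **`Z22:(7.21)` as an EDGE.** The printed inference "Hence `S*ⱼ(𝐚₁,𝐚₂) = S_j(𝐚₁,𝐚₂)`"
(§7 p. 41, (7.21)) from `Step7u055` and the `λ₀ⱼ`-factorisation `Step7u057`
(`λ₀ⱼ(drn)Σ_{n=d₁k₁,(k₁,r)=1}… = λ₀ⱼ(dr)ξ₀ⱼ(n;d,r)`): pull `λ₀ⱼ(dr)` out of the `n`-sum, exchange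
`Σ_r Σ_d`; the result is `Skeleton.Sj c′ D j 𝐚₁ 𝐚₂` verbatim. Kernel-checked.
[cite: Zhang2022LandauSiegel, §7 (7.21) p.41, tex L2165] -/
theorem eq721_of_steps (c' : ℝ) (h55 : Step7u055 c') (h57 : Step7u057 c') : Eq721 c' := by
  intro D B j a₁ a₂ ha₁ ha₂
  rw [h55 D B j a₁ a₂ ha₁ ha₂, Skeleton.Sj, Finset.sum_comm]
  refine Finset.sum_congr rfl fun d hd => Finset.sum_congr rfl fun r hr => ?_
  rw [Finset.mem_Ico] at hd hr
  have hn : ∀ n ∈ Finset.Ico 1 (Skeleton.Nsupp D),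
      a₂ (d * r * n) * Skeleton.lamZero c' D j (d * r * n) / (n : ℂ) *
          ∑ k₁ ∈ n.divisors.filter (fun k₁ => Nat.Coprime k₁ r),
            Skeleton.kappaTildeZero c' D j (n / k₁) (d * r * k₁) * (μ k₁ : ℂ) *
              (k₁ : ℂ) ^ (1 - Skeleton.betaJ c' D j) / (Nat.totient k₁ : ℂ) =
        Skeleton.lamZero c' D j (d * r) *
          (a₂ (d * r * n) * Skeleton.xiZero c' D j n d r / (n : ℂ)) := by
    intro n hn
    have key := h57 D j d r n hd.1 hr.1 (Finset.mem_Ico.mp hn).1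
    rw [div_mul_eq_mul_div, mul_assoc, key]
    ring
  rw [Finset.sum_congr rfl hn, ← Finset.mul_sum]
  push_cast
  ring

/-- **`Z22:(7.21)` from `Z22:§7.u057` alone** (`Z22:§7.u055` being a theorem):
`Step7u057 c′ → Eq721 c′`. [cite: Zhang2022LandauSiegel, §7 (7.21) p.41, tex L2165] -/
theorem eq721_of_step7u057 (c' : ℝ) (h57 : Step7u057 c') : Eq721 c' :=
  eq721_of_steps c' (step7u055_holds c') h57

end Literature.NumberTheory.LFunctions.Zhang2022.Section7dStatements
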